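import Mathlib.Analysis.InnerProductSpace.Projection.Reflection
import Mathlib.Topology.Compactification.OnePoint.Sphere
import Literature.Topology.FourManifolds.SliceKnots
import Literature.Topology.FourManifolds.SchoenfliesSeparation
import Literature.Topology.FourManifolds.SphereHypersurfaceCollar
import HarnessLib

/-!
# Proof of the smooth generalised Schoenflies theorem up to homeomorphism (`spc4.S21`)

Topic `Literature/Topology/FourManifolds`; sibling proofs file of `SliceKnots.lean` for its
Schoenflies fact `spc4.S21` (the Fox–Milnor reductions live in `SliceKnotsProofs.lean`).
**Everything in this file is proved**; it discharges the named fact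
`Literature.Topology.FourManifolds.exists_homeomorph_image_eq_sphereEquator_of_sphereEmbedding`:

> every smooth sphere embedding `K : Sⁿ ↪ Sⁿ⁺¹` is standard up to homeomorphism — some
> self-homeomorphism of `Sⁿ⁺¹` carries `K(Sⁿ)` onto the standard equator
> `Literature.Topology.FourManifolds.sphereEquator n = {x | x_{n+1} = 0}`

(Brown 1960, Mazur 1959: the generalised Schoenflies theorem for bicollared spheres; a smooth
codimension-one sphere is bicollared).

## Proof

* `n ≥ 1` (`exists_homeomorph_image_range_eq_setOf`): by `SphereHypersurfaceCollar.lean` the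
  smoothly embedded sphere has a bicollar `h : Sⁿ × [-1, 1] ↪ Sⁿ⁺¹`, `h(x, 0) = K x` (normal field
  by cross products + the tubular neighbourhood theorem for normally framed maps, Hirsch 1976,
  Ch. 4, §5); Brown's theorem as printed in Daverman (1986), §II.6, Thm. 6 — proved in the tree,
  `Literature.Topology.FourManifolds.exists_homeomorph_sphere_image_collar_eq_equator`
  (`SchoenfliesSeparation.lean`, ambient dimension `n + 1 ≥ 2`) — gives a homeomorphism onto the
  equator `{x | x₀ = 0}`, and the coordinate transposition `x₀ ↔ x_{n+1}`
  (`spherePermHomeomorph`) moves it to `sphereEquator n`.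
* `n = 0` (`exists_homeomorph_image_eq_sphereEquator_zero`): `K(S⁰)` is a pair of distinct
  points `P ≠ Q` of the circle, and the homeomorphism group of a round sphere is doubly
  transitive in the required sense (`exists_homeomorph_sphere_apply_eq_and_eq_neg`: some
  homeomorphism sends `P ↦ T`, `Q ↦ -T`): conjugate a translation of the hyperplane `(ℝ P)ᗮ` by
  the stereographic projection from `P` (Mathlib's `onePointHyperplaneHomeoUnitSphere`; it fixes
  `P` and moves `Q` to `-P`), then apply the reflection exchanging `P` and `T`
  (`Submodule.reflection_sub`).

## References

* M. Brown, *A proof of the generalized Schoenflies theorem*, Bull. Amer. Math. Soc. 66 (1960)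
  74–76. [Brown1960]
* B. Mazur, *On embeddings of spheres*, Bull. Amer. Math. Soc. 65 (1959) 59–65.
* R. J. Daverman, *Decompositions of manifolds* (1986), §II.6, Thm. 6 (PDF p. 40). [Daverman1986]
* M. W. Hirsch, *Differential Topology* (1976), Ch. 4, §5, Thms. 5.1–5.2. [HirschDT1976]
-/

open scoped Manifold ContDiff Topology RealInnerProductSpace
open Set Function Metric Module

noncomputable section

namespace Literature.Topology.FourManifolds

/-- Local notation: `𝔼 n` is the model Euclidean space `EuclideanSpace ℝ (Fin n)`. -/
local notation "𝔼 " n:arg => EuclideanSpace ℝ (Fin n)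

/-- Local notation: `𝕊 n` is the unit sphere in `EuclideanSpace ℝ (Fin (n + 1))`. -/
local notation "𝕊 " n:arg => (Metric.sphere (0 : EuclideanSpace ℝ (Fin (n + 1))) 1)

/-! ### Dimension `n ≥ 1`: bicollar and Brown's theorem -/

/-- **Smooth codimension-one spheres are topologically standard** (`m ≥ 1`, equator `{x₀ = 0}`):
a `C^∞` embedding `f : 𝕊 m → 𝕊 (m+1)` is bicollared (`exists_collar_of_isSmoothEmbedding`), so by
Brown's generalised Schoenflies theorem (Daverman 1986, Thm. II.6.6, proved as
`exists_homeomorph_sphere_image_collar_eq_equator`) some self-homeomorphism of `𝕊 (m+1)` carries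
its image onto `{x | x₀ = 0}`. [cite: Brown1960, Bull. AMS 66; via Daverman1986 §II.6 Thm. 6] -/
theorem exists_homeomorph_image_range_eq_setOf {m : ℕ} (hm : 1 ≤ m) {f : 𝕊 m → 𝕊 (m + 1)}
    (hf : Manifold.IsSmoothEmbedding (𝓡 m) (𝓡 (m + 1)) ∞ f) :
    ∃ F : 𝕊 (m + 1) ≃ₜ 𝕊 (m + 1),
      F '' range f = {v : 𝕊 (m + 1) | (v : 𝔼 (m + 1 + 1)) 0 = 0} := by
  obtain ⟨h, hcont, hinj, -, himage⟩ := exists_collar_of_isSmoothEmbedding hf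
  obtain ⟨F, hF⟩ :=
    exists_homeomorph_sphere_image_collar_eq_equator (n := m + 1) (by omega) hcont hinj
  exact ⟨F, by rw [← himage]; exact hF⟩

/-- The self-homeomorphism of the round sphere of `ℝᵏ` induced by a permutation `σ` of the
coordinates (the linear isometry `LinearIsometryEquiv.piLpCongrLeft`, `(x_i) ↦ (x_{σ⁻¹ i})`,
restricted to the sphere). [folklore] -/
def spherePermHomeomorph {k : ℕ} (σ : Equiv.Perm (Fin k)) :
    sphere (0 : 𝔼 k) 1 ≃ₜ sphere (0 : 𝔼 k) 1 :=
  (LinearIsometryEquiv.piLpCongrLeft 2 ℝ ℝ σ).toHomeomorph.subtype fun v => by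
    rw [mem_sphere_zero_iff_norm, mem_sphere_zero_iff_norm, LinearIsometryEquiv.coe_toHomeomorph,
      LinearIsometryEquiv.norm_map]

/-- Coordinates of the permuted point: `(σ • x)_i = x_{σ⁻¹ i}`. [folklore] -/
theorem coe_spherePermHomeomorph_apply {k : ℕ} (σ : Equiv.Perm (Fin k)) (v : sphere (0 : 𝔼 k) 1)
    (i : Fin k) : (spherePermHomeomorph σ v : 𝔼 k) i = (v : 𝔼 k) (σ.symm i) := by
  show LinearIsometryEquiv.piLpCongrLeft 2 ℝ ℝ σ (v : 𝔼 k) i = (v : 𝔼 k) (σ.symm i)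
  rw [LinearIsometryEquiv.piLpCongrLeft_apply, Equiv.piCongrLeft'_apply]

/-- A coordinate permutation carries the great sphere `{x_i = 0}` onto `{x_{σ i} = 0}`.
[folklore] -/
theorem image_spherePermHomeomorph_setOf {k : ℕ} (σ : Equiv.Perm (Fin k)) (i : Fin k) :
    spherePermHomeomorph σ '' {v : sphere (0 : 𝔼 k) 1 | (v : 𝔼 k) i = 0} =
      {v : sphere (0 : 𝔼 k) 1 | (v : 𝔼 k) (σ i) = 0} := by
  ext v
  constructor
  · rintro ⟨w, hw, rfl⟩
    show (spherePermHomeomorph σ w : 𝔼 k) (σ i) = 0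
    rw [coe_spherePermHomeomorph_apply, Equiv.symm_apply_apply]
    exact hw
  · intro hv
    refine ⟨(spherePermHomeomorph σ).symm v, ?_, (spherePermHomeomorph σ).apply_symm_apply v⟩
    show (((spherePermHomeomorph σ).symm v : sphere (0 : 𝔼 k) 1) : 𝔼 k) i = 0
    have h := coe_spherePermHomeomorph_apply σ ((spherePermHomeomorph σ).symm v) (σ i)
    rw [(spherePermHomeomorph σ).apply_symm_apply, Equiv.symm_apply_apply] at h
    rw [← h]
    exact hv

/-! ### Dimension `n = 0`: two points on a circle -/

/-- **Double transitivity of the homeomorphisms of a round sphere** (the form needed for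
`S⁰ ⊂ S¹`): for points `P ≠ Q` and `T` of the unit sphere of a finite-dimensional inner product
space there is a self-homeomorphism `φ` of the sphere with `φ P = T` and `φ Q = -T`.  Proof: the
stereographic projection from `P` identifies the sphere with the one-point compactification of
the hyperplane `(ℝ P)ᗮ` (Mathlib's `onePointHyperplaneHomeoUnitSphere`, `∞ ↦ P`, `0 ↦ -P`);
conjugating the translation by `-(image of Q)` gives a homeomorphism fixing `P` and taking `Q` to
`-P`; then the reflection in the bisector hyperplane of `P` and `T` takes `±P` to `±T`.
[folklore] -/
theorem exists_homeomorph_sphere_apply_eq_and_eq_neg {E : Type*} [NormedAddCommGroup E]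
    [InnerProductSpace ℝ E] [FiniteDimensional ℝ E] {P Q : sphere (0 : E) 1} (hPQ : P ≠ Q)
    (T : sphere (0 : E) 1) :
    ∃ φ : sphere (0 : E) 1 ≃ₜ sphere (0 : E) 1, φ P = T ∧ φ Q = -T := by
  -- step 1: stereographic conjugation of a translation
  let Ψ : OnePoint (ℝ ∙ (P : E))ᗮ ≃ₜ sphere (0 : E) 1 :=
    onePointHyperplaneHomeoUnitSphere (norm_eq_of_mem_sphere P)
  have hΨinf : Ψ OnePoint.infty = P := rfl
  let w₀ : (ℝ ∙ (P : E))ᗮ := stereographic (norm_eq_of_mem_sphere P) Q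
  have hQsrc : Q ∈ (stereographic (norm_eq_of_mem_sphere P)).source := by
    rw [stereographic_source, mem_compl_singleton_iff]
    intro h
    exact hPQ (Subtype.ext (congrArg Subtype.val h)).symm
  have hΨw₀ : Ψ (w₀ : OnePoint (ℝ ∙ (P : E))ᗮ) = Q :=
    (stereographic (norm_eq_of_mem_sphere P)).left_inv hQsrc
  have hPsrc : -P ∈ (stereographic (norm_eq_of_mem_sphere P)).source := by
    rw [stereographic_source, mem_compl_singleton_iff]
    intro h
    exact ne_neg_of_mem_unit_sphere ℝ P (Subtype.ext (congrArg Subtype.val h)).symm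
  have hΨ0 : Ψ ((0 : (ℝ ∙ (P : E))ᗮ) : OnePoint (ℝ ∙ (P : E))ᗮ) = -P := by
    have h := (stereographic (norm_eq_of_mem_sphere P)).left_inv hPsrc
    rw [stereographic_apply_neg] at h
    exact h
  let τ : (ℝ ∙ (P : E))ᗮ ≃ₜ (ℝ ∙ (P : E))ᗮ := Homeomorph.addRight (-w₀)
  let φ₁ : sphere (0 : E) 1 ≃ₜ sphere (0 : E) 1 := Ψ.symm.trans (τ.onePointCongr.trans Ψ)
  have hφ₁P : φ₁ P = P := by
    have h1 : Ψ.symm P = OnePoint.infty :=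
      Ψ.injective (by rw [Ψ.apply_symm_apply]; exact hΨinf.symm)
    show Ψ (τ.onePointCongr (Ψ.symm P)) = P
    rw [h1, Homeomorph.onePointCongr_apply, OnePoint.map_infty]
    exact hΨinf
  have hφ₁Q : φ₁ Q = -P := by
    have h1 : Ψ.symm Q = (w₀ : OnePoint (ℝ ∙ (P : E))ᗮ) :=
      Ψ.injective (by rw [Ψ.apply_symm_apply, hΨw₀])
    show Ψ (τ.onePointCongr (Ψ.symm Q)) = -P
    rw [h1, Homeomorph.onePointCongr_apply, OnePoint.map_some]
    have h2 : τ w₀ = 0 := by simp [τ]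
    rw [h2, hΨ0]
  -- step 2: the reflection exchanging `P` and `T`
  let R : E ≃ₗᵢ[ℝ] E := (ℝ ∙ ((P : E) - T))ᗮ.reflection
  have hRP : R P = T :=
    Submodule.reflection_sub (by rw [norm_eq_of_mem_sphere P, norm_eq_of_mem_sphere T])
  let φ₂ : sphere (0 : E) 1 ≃ₜ sphere (0 : E) 1 :=
    R.toHomeomorph.subtype (p := (· ∈ sphere (0 : E) 1)) (q := (· ∈ sphere (0 : E) 1)) fun x => by
      rw [mem_sphere_zero_iff_norm, mem_sphere_zero_iff_norm, LinearIsometryEquiv.coe_toHomeomorph,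
        LinearIsometryEquiv.norm_map]
  have hφ₂ : ∀ x : sphere (0 : E) 1, ((φ₂ x : sphere (0 : E) 1) : E) = R x := fun x => rfl
  refine ⟨φ₁.trans φ₂, ?_, ?_⟩
  · rw [Homeomorph.trans_apply, hφ₁P]
    exact Subtype.ext (by rw [hφ₂, hRP])
  · rw [Homeomorph.trans_apply, hφ₁Q]
    refine Subtype.ext ?_
    rw [hφ₂, coe_neg_sphere, map_neg, hRP, coe_neg_sphere]

/-- The `0`-sphere consists of the two points `±e₀`. [folklore] -/
theorem eq_or_eq_neg_of_sphere_zero (x : 𝕊 0) :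
    x = ⟨EuclideanSpace.single 0 1, by simp⟩ ∨ x = -⟨EuclideanSpace.single 0 1, by simp⟩ := by
  have hx : (x : 𝔼 1) 0 * (x : 𝔼 1) 0 = 1 := by
    have h := norm_eq_of_mem_sphere x
    rw [EuclideanSpace.norm_eq, Real.sqrt_eq_one] at h
    rw [← pow_two]
    simpa [Fin.sum_univ_one, Real.norm_eq_abs, sq_abs] using h
  rcases mul_self_eq_one_iff.1 hx with h | h
  · left
    refine Subtype.ext ?_
    ext i
    obtain rfl : i = 0 := Fin.fin_one_eq_zero i
    simpa using h
  · right
    refine Subtype.ext ?_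
    ext i
    obtain rfl : i = 0 := Fin.fin_one_eq_zero i
    simpa using h

/-- The standard inclusion of spheres commutes with the antipodal map. [folklore] -/
theorem sphereInclusion_neg {k n : ℕ} (h : k ≤ n) (x : 𝕊 k) :
    sphereInclusion k n h (-x) = -sphereInclusion k n h x := by
  refine Subtype.ext ?_
  ext i
  simp only [coe_sphereInclusion, coe_neg_sphere, WithLp.ofLp_neg, Pi.neg_apply,
    euclideanInclusion_apply]
  split_ifs <;> simp

/-- **The case `S⁰ ⊂ S¹`**: two distinct points of the circle are carried onto the standard pair
`sphereEquator 0 = {(±1, 0)}` by a homeomorphism of the circle. [folklore] -/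
theorem exists_homeomorph_image_eq_sphereEquator_zero (K : SphereEmbedding 0 1) :
    ∃ φ : 𝕊 1 ≃ₜ 𝕊 1, φ '' range K = sphereEquator 0 := by
  set a : 𝕊 0 := ⟨EuclideanSpace.single 0 1, by simp⟩ with ha
  have h2 : ∀ x : 𝕊 0, x = a ∨ x = -a := eq_or_eq_neg_of_sphere_zero
  have hrange : range K = {K a, K (-a)} := by
    ext y
    constructor
    · rintro ⟨x, rfl⟩
      rcases h2 x with rfl | rfl
      · exact Or.inl rfl
      · exact Or.inr rfl
    · rintro (rfl | rfl)
      · exact ⟨a, rfl⟩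
      · exact ⟨-a, rfl⟩
  have hne : K a ≠ K (-a) := fun h => ne_neg_of_mem_unit_sphere ℝ a (K.injective h)
  set T : 𝕊 1 := sphereInclusion 0 (0 + 1) (Nat.le_succ 0) a with hT
  have hequator : sphereEquator 0 = {T, -T} := by
    ext y
    constructor
    · rintro ⟨x, rfl⟩
      rcases h2 x with rfl | rfl
      · exact Or.inl rfl
      · exact Or.inr (sphereInclusion_neg _ a)
    · rintro (rfl | rfl)
      · exact ⟨a, rfl⟩
      · exact ⟨-a, sphereInclusion_neg _ a⟩
  obtain ⟨φ, hP, hQ⟩ := exists_homeomorph_sphere_apply_eq_and_eq_neg hne T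
  refine ⟨φ, ?_⟩
  rw [hrange, hequator, image_pair, hP, hQ]

/-! ### The theorem -/

/-- **Discharge of the named fact
`Literature.Topology.FourManifolds.exists_homeomorph_image_eq_sphereEquator_of_sphereEmbedding`**
(`spc4.S21`, smooth spheres are standard up to homeomorphism in every dimension): for every
smooth sphere embedding `K : Sⁿ ↪ Sⁿ⁺¹` some self-homeomorphism of `Sⁿ⁺¹` carries `K(Sⁿ)` onto the
standard equator.  Brown (1960) / Mazur (1959) for the bicollared sphere `K(Sⁿ)` (`n ≥ 1`; the
collar from the trivial normal bundle and the tubular neighbourhood theorem, Hirsch 1976, Ch. 4,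
§5), read through Daverman (1986), §II.6, Thm. 6; `n = 0` directly.
[cite: Brown1960, Bull. AMS 66; via Daverman1986 §II.6 Thm. 6] -/
theorem exists_homeomorph_image_eq_sphereEquator_of_sphereEmbedding_holds :
    exists_homeomorph_image_eq_sphereEquator_of_sphereEmbedding := by
  intro n K
  rcases Nat.eq_zero_or_pos n with rfl | hn
  · exact exists_homeomorph_image_eq_sphereEquator_zero K
  · obtain ⟨F, hF⟩ := exists_homeomorph_image_range_eq_setOf hn (f := ⇑K) K.isSmoothEmbedding
    refine ⟨F.trans (spherePermHomeomorph (Equiv.swap 0 (Fin.last (n + 1)))), ?_⟩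
    rw [show ⇑(F.trans (spherePermHomeomorph (Equiv.swap 0 (Fin.last (n + 1))))) =
        spherePermHomeomorph (Equiv.swap 0 (Fin.last (n + 1))) ∘ F from rfl, image_comp, hF,
      image_spherePermHomeomorph_setOf, Equiv.swap_apply_left]
    ext v
    exact (mem_sphereEquator_iff v).symm

end Literature.Topology.FourManifolds
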